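import Literature.AlgebraicGeometry.CubicSurfaces.FermatCubicLines
import Literature.AlgebraicGeometry.CubicSurfaces.OccultSystemProofs
import Literature.NumberTheory.GaloisRepresentations.IntegralGaloisActionProofs
import Mathlib.RingTheory.RootsOfUnity.AlgebraicallyClosed
import HarnessLib

/-!
# The occult residual clause for the Fermat cubic

The named fact `CubicSurface.exists_occultSystem` [AllcockCarlsonToledo2002; Achter2014]
applies to the smooth cubic form `x₀³ + x₁³ + x₂³ + x₃³` over `ℚ` (`isSmoothCubic_fermatCubic_rat`),
and for this surface its residual clause (3) can be evaluated completely, because the `27` lines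
are defined over `ℚ(ω)` (`FermatCubicLines.lean`, [Hartshorne1977, V Ex 4.16]):

* `galConj_eqLine`: Galois conjugation moves the plane `{x_i = α x_j, x_k = β x_l}` to
  `{x_i = σ(α) x_j, x_k = σ(β) x_l}`; hence an automorphism of `K/k` fixing `ω` fixes each of the
  `27` lines (`smul_fermatLine`) and so — by completeness of the `27` — every line of the Fermat
  cubic (`smul_lines_fermatCubic`); the induced permutation of the `27` symbols is trivial for any
  marking (`SchlafliMarking.perm_eq_one_of_smul_omega`) and the mod-`3` orthogonal representation
  is trivial (`linesQuadRep_fermatCubic_eq_one`).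
* `absGaloisRestrict_smul_eq_of_pow_three_eq_one`: under the restriction
  `Γ_{ℚ(ζ₃)} → Γ_ℚ` of `AbsGaloisGroup.lean`, `Γ_{ℚ(ζ₃)}` fixes the cube roots of unity of `ℚ̄`.
* `IsOccultSystem.fermat_residual`: consequently, for every occult system `𝓢` of the Fermat cubic,
  clause (3) (through `IsOccultSystem.residual_frameMatrix` and `frameMatrix 1 = 1`) says that at
  every good place `v` the Frobenius polynomial `charpoly v` has an integral model
  `P₀ ≡ (X - 1)⁵ (mod λ₃)` for every arithmetic Frobenius at every prime above `v` (the form of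
  the clause); since such primes and Frobenius elements exist
  (`HeightOneSpectrum.primesAbove_nonempty`,
  `HeightOneSpectrum.exists_isArithFrobAt_of_mem_primesAbove_holds` of
  `IntegralGaloisAction(Proofs).lean`), the congruence holds outright
  (`IsOccultSystem.fermat_charpoly_mod`).  `exists_occultSystem.fermat` and
  `exists_occultSystem.fermat_charpoly_mod` package the prediction of the named fact for this one
  surface.  This is the expected congruence: `H³` of the Fermat cubic threefold is of CM type and
  its Frobenius eigenvalues are Jacobi sums, `≡ 1 (mod (1 - ω))`.

## References

* [Hartshorne1977] R. Hartshorne, *Algebraic Geometry* (1977), V Ex 4.16.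
* [AllcockCarlsonToledo2002] D. Allcock, J. Carlson, D. Toledo, J. Algebraic Geom. 11 (2002),
  (2.12), (4.8)–(4.10).
* [Achter2014] J. Achter, Trans. AMS 366 (2014), Lemma 4.4, Prop 4.5.
-/

noncomputable section

open Module MvPolynomial

namespace Literature.AlgebraicGeometry.CubicSurfaces

namespace CubicSurface

/-! ## Galois conjugation of the planes `{x_i = α x_j, x_k = β x_l}` -/

section GalConjEqLine

variable {G : Type*} [Group G] {K : Type*} [Field K] [MulSemiringAction G K]

/-- Galois conjugation acts on the planes `{x_i = α x_j, x_k = β x_l}` through the slopes: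
`σ • {x_i = α x_j, x_k = β x_l} = {x_i = σ(α) x_j, x_k = σ(β) x_l}`. [folklore] -/
theorem galConj_eqLine (σ : G) (i j k l : Fin 4) (α β : K) :
    galConj σ (eqLine K i j k l α β) = eqLine K i j k l (σ • α) (σ • β) := by
  ext v
  simp only [mem_galConj, mem_eqLine, Pi.smul_apply]
  have key : ∀ x y c : K, σ⁻¹ • x = c * σ⁻¹ • y ↔ x = σ • c * y := fun x y c => by
    constructor
    · intro h
      have h' := congrArg (fun z : K => σ • z) h
      simpa only [smul_mul', smul_inv_smul] using h'
    · intro h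
      rw [h, smul_mul', inv_smul_smul]
  rw [key, key]

end GalConjEqLine

/-! ## Automorphisms fixing `ω` fix the `27` lines of the Fermat cubic -/

section Fixed

variable {k : Type*} [Field k] {K : Type*} [Field K] [Algebra k K] {ω : K}
variable {G : Type*} [Group G] [MulSemiringAction G K] [SMulCommClass G k K]

/-- An automorphism fixing `ω` fixes the cube roots `-ω^e` of `-1`. [folklore] -/
theorem smul_croot (σ : G) (hσ : σ • ω = ω) (e : ZMod 3) : σ • croot ω e = croot ω e := by
  simp only [croot, zpow3, smul_neg, smul_pow', hσ]

/-- **An automorphism of `K/k` fixing `ω` fixes each of the `27` lines of the Fermat cubic**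
(their equations have coefficients in `ℚ(ω)`). [cite: Hartshorne1977, V Ex 4.16] -/
theorem smul_fermatLine (hω : IsPrimitiveRoot ω 3) (σ : G) (hσ : σ • ω = ω) (u : FermatIdx) :
    σ • fermatLine k K hω u = fermatLine k K hω u := by
  apply Subtype.ext
  rw [coe_smul_lines, coe_fermatLine]
  show galConj σ (eqLine K 0 _ _ _ _ _) = eqLine K 0 _ _ _ _ _
  rw [galConj_eqLine, smul_croot σ hσ, smul_croot σ hσ]

/-- Hence (completeness of the `27`) such an automorphism fixes **every** line of the Fermat
cubic over `K`. [cite: Hartshorne1977, V Ex 4.16] -/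
theorem smul_lines_fermatCubic (hω : IsPrimitiveRoot ω 3) (σ : G) (hσ : σ • ω = ω)
    (ℓ : lines K (fermatCubic k)) : σ • ℓ = ℓ := by
  obtain ⟨u, rfl⟩ := fermatLine_surjective k K hω ℓ
  exact smul_fermatLine hω σ hσ u

/-- The induced permutation of the `27` symbols is trivial, for any marking of the Fermat
cubic. [folklore] -/
theorem SchlafliMarking.perm_eq_one_of_smul_omega (hω : IsPrimitiveRoot ω 3)
    (m : SchlafliMarking K (fermatCubic k)) (σ : G) (hσ : σ • ω = ω) : m.perm σ = 1 :=
  (m.perm_eq_one_iff σ).2 (smul_lines_fermatCubic hω σ hσ)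

/-- The mod-`3` orthogonal representation of the lines of the Fermat cubic is trivial on
automorphisms fixing `ω`. [folklore] -/
theorem linesQuadRep_fermatCubic_eq_one (hω : IsPrimitiveRoot ω 3) (σ : G) (hσ : σ • ω = ω) :
    linesQuadRep K (fermatCubic k) σ = 1 :=
  linesQuadRep_eq_one K _ (smul_lines_fermatCubic hω σ hσ)

end Fixed

/-! ## The residual clause of an occult system of the Fermat cubic over `ℚ` -/

section Arithmetic

open Polynomial NumberField IsDedekindDomain Field
open Literature.NumberTheory.GaloisRepresentations

/-- `ℚ(ζ₃) = CyclotomicField 3 ℚ` contains a primitive cube root of unity (from the instance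
`CyclotomicField.isCyclotomicExtension`, applied as a term to sidestep the `ℚ`-algebra instance
clash `DivisionRing.toRatAlgebra` vs `CyclotomicField.algebra`; the statement itself mentions no
`ℚ`-algebra structure). [folklore] -/
theorem exists_isPrimitiveRoot_cyclotomicField_three :
    ∃ ζ : CyclotomicField 3 ℚ, IsPrimitiveRoot ζ 3 :=
  (CyclotomicField.isCyclotomicExtension 3 ℚ).exists_isPrimitiveRoot (Set.mem_singleton 3)
    three_ne_zero

/-- The Fermat cubic over `ℚ` is a smooth cubic form. [folklore] -/
theorem isSmoothCubic_fermatCubic_rat : IsSmoothCubic (fermatCubic ℚ) :=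
  isSmoothCubic_fermatCubic ℚ three_ne_zero

/-- **`Γ_{ℚ(ζ₃)}` fixes the cube roots of unity of `ℚ̄`** under the restriction
`absGaloisRestrict ℚ ℚ(ζ₃) : Γ_{ℚ(ζ₃)} → Γ_ℚ` (the chosen embedding `ℚ̄ → \overline{ℚ(ζ₃)}`
sends a cube root of unity to a power of `ζ₃`, which `Γ_{ℚ(ζ₃)}` fixes). [folklore] -/
theorem absGaloisRestrict_smul_eq_of_pow_three_eq_one
    (σ : absoluteGaloisGroup (CyclotomicField 3 ℚ)) {ω : AlgebraicClosure ℚ} (hω : ω ^ 3 = 1) :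
    absGaloisRestrict ℚ (CyclotomicField 3 ℚ) σ • ω = ω := by
  apply (absClosureEmbedding ℚ (CyclotomicField 3 ℚ)).toRingHom.injective
  change absClosureEmbedding ℚ (CyclotomicField 3 ℚ)
      (absGaloisRestrict ℚ (CyclotomicField 3 ℚ) σ • ω) =
    absClosureEmbedding ℚ (CyclotomicField 3 ℚ) ω
  rw [absGaloisRestrict_apply_smul]
  obtain ⟨ζ, hζ0⟩ := exists_isPrimitiveRoot_cyclotomicField_three
  have hζ : IsPrimitiveRoot
      (algebraMap (CyclotomicField 3 ℚ) (AlgebraicClosure (CyclotomicField 3 ℚ)) ζ) 3 :=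
    hζ0.map_of_injective
      (algebraMap (CyclotomicField 3 ℚ) (AlgebraicClosure (CyclotomicField 3 ℚ))).injective
  have hιω : (absClosureEmbedding ℚ (CyclotomicField 3 ℚ) ω) ^ 3 = 1 := by
    rw [← map_pow, hω, map_one]
  obtain ⟨i, -, hi⟩ := hζ.eq_pow_of_pow_eq_one hιω
  rw [← hi, ← map_pow]
  exact AlgEquiv.commutes σ (ζ ^ i)

variable {𝓢 : CompatibleSystem (CyclotomicField 3 ℚ) (CyclotomicField 3 ℚ) 5}

/-- **The residual clause for the Fermat cubic: Frobenius polynomials `≡ (X - 1)⁵ (mod λ₃)`.**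
For an occult system `𝓢` of `x₀³ + x₁³ + x₂³ + x₃³` over `ℚ`, clause (3) of `IsOccultSystem`
pins the reduction of the Frobenius polynomials: there is a prime `λ ∋ 3` of `ℤ[ω]` such that at
every good place `v`, `charpoly v` has an integral model `P₀` with `P₀ ≡ (X - 1)⁵ (mod λ)`
(granted an arithmetic Frobenius at a prime above `v`, over which the clause quantifies) — because
`Γ_{ℚ(ω)}` fixes all `27` lines, so acts trivially on `V(S)`.  (Consistent with the CM
description of `H³` of the Fermat cubic threefold by Jacobi-sum Hecke characters.)
[cite: AllcockCarlsonToledo2002, (2.12), (4.8)–(4.10)] -/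
theorem IsOccultSystem.fermat_residual (h : IsOccultSystem (fermatCubic ℚ) 𝓢) :
    ∃ («λ» : HeightOneSpectrum (𝓞 (CyclotomicField 3 ℚ))),
      (3 : 𝓞 (CyclotomicField 3 ℚ)) ∈ «λ».asIdeal ∧
      ∀ v : HeightOneSpectrum (𝓞 (CyclotomicField 3 ℚ)), v ∉ 𝓢.bad →
        ∃ P₀ : Polynomial (𝓞 (CyclotomicField 3 ℚ)),
          P₀.map (algebraMap (𝓞 (CyclotomicField 3 ℚ)) (CyclotomicField 3 ℚ)) = 𝓢.charpoly v ∧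
          ∀ 𝔓 ∈ v.primesAbove, ∀ σ : absoluteGaloisGroup (CyclotomicField 3 ℚ),
            IsArithFrobAt (𝓞 (CyclotomicField 3 ℚ)) σ 𝔓 →
            P₀.map (Ideal.Quotient.mk «λ».asIdeal) = (Polynomial.X - 1) ^ 5 := by
  obtain ⟨ω, hω⟩ := HasEnoughRootsOfUnity.exists_primitiveRoot (AlgebraicClosure ℚ) 3
  obtain ⟨«λ», j, h3, H⟩ := h.residual_frameMatrix (fermatMarking ℚ (AlgebraicClosure ℚ) hω)
  refine ⟨«λ», h3, fun v hv => ?_⟩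
  obtain ⟨P₀, hP₀, hF⟩ := H v hv
  refine ⟨P₀, hP₀, fun 𝔓 h𝔓 σ hσ => ?_⟩
  have key := hF 𝔓 h𝔓 σ hσ
  rw [SchlafliMarking.perm_eq_one_of_smul_omega hω _ _
      (absGaloisRestrict_smul_eq_of_pow_three_eq_one σ hω.pow_eq_one),
    SchlafliMarking.frameMatrix_one, Matrix.charpoly_one, Fintype.card_fin] at key
  rw [← key, Polynomial.map_pow, Polynomial.map_sub, Polynomial.map_X, Polynomial.map_one]

/-- **The named fact specialised to the Fermat cubic.**  `CubicSurface.exists_occultSystem`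
applies to `x₀³ + x₁³ + x₂³ + x₃³` (a smooth cubic form over `ℚ`) and then predicts a rank-`5`
compatible system over `ℚ(ω)`, pure of weight `3`, polarised, whose Frobenius polynomials are
`≡ (X - 1)⁵` modulo `λ₃ = (1 - ω)` at every good place (granted a Frobenius there).
[cite: AllcockCarlsonToledo2002, (2.2)–(2.7), (2.12), (4.8)–(4.10)] -/
theorem exists_occultSystem.fermat (hocc : exists_occultSystem) :
    ∃ 𝓢 : CompatibleSystem (CyclotomicField 3 ℚ) (CyclotomicField 3 ℚ) 5,
      IsOccultSystem (fermatCubic ℚ) 𝓢 ∧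
      ∃ («λ» : HeightOneSpectrum (𝓞 (CyclotomicField 3 ℚ))),
        (3 : 𝓞 (CyclotomicField 3 ℚ)) ∈ «λ».asIdeal ∧
        ∀ v : HeightOneSpectrum (𝓞 (CyclotomicField 3 ℚ)), v ∉ 𝓢.bad →
          ∃ P₀ : Polynomial (𝓞 (CyclotomicField 3 ℚ)),
            P₀.map (algebraMap (𝓞 (CyclotomicField 3 ℚ)) (CyclotomicField 3 ℚ)) = 𝓢.charpoly v ∧
            ∀ 𝔓 ∈ v.primesAbove, ∀ σ : absoluteGaloisGroup (CyclotomicField 3 ℚ),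
              IsArithFrobAt (𝓞 (CyclotomicField 3 ℚ)) σ 𝔓 →
              P₀.map (Ideal.Quotient.mk «λ».asIdeal) = (Polynomial.X - 1) ^ 5 := by
  obtain ⟨𝓢, h𝓢⟩ := hocc (fermatCubic ℚ) isSmoothCubic_fermatCubic_rat
  exact ⟨𝓢, h𝓢, h𝓢.fermat_residual⟩

/-- **Frobenius polynomials of an occult system of the Fermat cubic are `≡ (X - 1)⁵ (mod λ₃)`**,
outright: primes of `\bar ℤ_K` above `v` and arithmetic Frobenius elements at them exist
(`HeightOneSpectrum.primesAbove_nonempty`,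
`HeightOneSpectrum.exists_isArithFrobAt_of_mem_primesAbove_holds`), so the quantifiers of
`IsOccultSystem.fermat_residual` can be instantiated.
[cite: AllcockCarlsonToledo2002, (2.12), (4.8)–(4.10)] -/
theorem IsOccultSystem.fermat_charpoly_mod (h : IsOccultSystem (fermatCubic ℚ) 𝓢) :
    ∃ («λ» : HeightOneSpectrum (𝓞 (CyclotomicField 3 ℚ))),
      (3 : 𝓞 (CyclotomicField 3 ℚ)) ∈ «λ».asIdeal ∧
      ∀ v : HeightOneSpectrum (𝓞 (CyclotomicField 3 ℚ)), v ∉ 𝓢.bad →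
        ∃ P₀ : Polynomial (𝓞 (CyclotomicField 3 ℚ)),
          P₀.map (algebraMap (𝓞 (CyclotomicField 3 ℚ)) (CyclotomicField 3 ℚ)) = 𝓢.charpoly v ∧
          P₀.map (Ideal.Quotient.mk «λ».asIdeal) = (Polynomial.X - 1) ^ 5 := by
  obtain ⟨«λ», h3, H⟩ := h.fermat_residual
  refine ⟨«λ», h3, fun v hv => ?_⟩
  obtain ⟨P₀, hP₀, hF⟩ := H v hv
  obtain ⟨𝔓, h𝔓⟩ := HeightOneSpectrum.primesAbove_nonempty (v := v)
  obtain ⟨σ, hσ⟩ := HeightOneSpectrum.exists_isArithFrobAt_of_mem_primesAbove_holds (v := v) h𝔓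
  exact ⟨P₀, hP₀, hF 𝔓 h𝔓 σ hσ⟩

/-- **The named fact specialised to the Fermat cubic, congruence form**: `exists_occultSystem`
predicts a rank-`5` occult system for `x₀³ + x₁³ + x₂³ + x₃³` over `ℚ(ω)` all of whose Frobenius
polynomials at good places are `≡ (X - 1)⁵ (mod λ₃)`.
[cite: AllcockCarlsonToledo2002, (2.2)–(2.7), (2.12), (4.8)–(4.10)] -/
theorem exists_occultSystem.fermat_charpoly_mod (hocc : exists_occultSystem) :
    ∃ 𝓢 : CompatibleSystem (CyclotomicField 3 ℚ) (CyclotomicField 3 ℚ) 5,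
      IsOccultSystem (fermatCubic ℚ) 𝓢 ∧
      ∃ («λ» : HeightOneSpectrum (𝓞 (CyclotomicField 3 ℚ))),
        (3 : 𝓞 (CyclotomicField 3 ℚ)) ∈ «λ».asIdeal ∧
        ∀ v : HeightOneSpectrum (𝓞 (CyclotomicField 3 ℚ)), v ∉ 𝓢.bad →
          ∃ P₀ : Polynomial (𝓞 (CyclotomicField 3 ℚ)),
            P₀.map (algebraMap (𝓞 (CyclotomicField 3 ℚ)) (CyclotomicField 3 ℚ)) = 𝓢.charpoly v ∧
            P₀.map (Ideal.Quotient.mk «λ».asIdeal) = (Polynomial.X - 1) ^ 5 := by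
  obtain ⟨𝓢, h𝓢⟩ := hocc (fermatCubic ℚ) isSmoothCubic_fermatCubic_rat
  exact ⟨𝓢, h𝓢, h𝓢.fermat_charpoly_mod⟩

end Arithmetic

end CubicSurface

end Literature.AlgebraicGeometry.CubicSurfaces

end
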